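import Summits.ResolutionOfSingularities.ResolutionOfSingularities.Theorems.RisoStrataRisoCentresResolvePCuspTools

/-!
# Route RisoStrata — crux `RisoCentresResolve` (stmt-ResolutionOfSingularities-18546), line `Sketch`:
# typed `Rtd` VANISHES at the vertex of the toric fourfold `T` (abstract core `toricT_vertex_core`)

Lead c2. `T = Spec k[ℕ⟨g₁, …, g₇⟩]` is the toric fourfold on which the constant top word of the
crux's schedule recurs; the open dichotomy of the standing disproof is whether the TYPED
riso-triviality dimension at the vertex of `T` is `0`. This file proves the abstract core:
seven coordinates `G 0, …, G 6 ∈ m` with the three binomial relations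
`G 0 · G 3 = G 1 · G 2`, `G 2 · G 5 = G 3 · G 4`, `G 2 · G 5 = G 0 · G 6`, the vertex arc
(`G i ↦ 0`) and, for `j < 4`, an exposing arc (`G j ↦ t`, `v (G i) > 1` for `i ≠ j`) admit no
typed straightener `(W, φ)` of rank `≥ 1`.  Mechanism (first order only): every direction
`u ∈ W ∖ 0` is realised at order `1` from every arc (`dir_realise`); the `t²`-coefficient of a
binomial relation along such a realisation is a quadratic identity in the leading coefficients
(`ttv_key`); at the vertex arc this gives `u₀u₃ = u₁u₂`, `u₂u₅ = u₃u₄`, `u₂u₅ = u₀u₆`, and at the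
four exposing arcs the same identities with one `u_j` replaced by `u_j + 1`; together `u = 0`.
Mathlib + tree only (`…DirCalculus`, `…PCuspTools`); no definitions, no named facts.
-/

noncomputable section

set_option linter.dupNamespace false

namespace Summit.ResolutionOfSingularities.ResolutionOfSingularities.Theorems

open Summit.ResolutionOfSingularities.ResolutionOfSingularities.Theses.RisoStrata

section ToricTVertex

variable {k : Type} [Field k]

/-- **The `t²`-coefficient of a product.** If `x = t a + O(t^{>1})`, `y = t b + O(t^{>1})`,
`x' = t a' + O(t^{>1})`, `y' = t b' + O(t^{>1})` and `x y = x' y'`, then `a b = a' b'`. -/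
theorem ttv_key {x y x' y' : HahnSeries ℚ k} {a b a' b' : k}
    (hx : ((1 : ℚ) : WithTop ℚ) < (x - HahnSeries.single (1 : ℚ) a).orderTop)
    (hy : ((1 : ℚ) : WithTop ℚ) < (y - HahnSeries.single (1 : ℚ) b).orderTop)
    (hx' : ((1 : ℚ) : WithTop ℚ) < (x' - HahnSeries.single (1 : ℚ) a').orderTop)
    (hy' : ((1 : ℚ) : WithTop ℚ) < (y' - HahnSeries.single (1 : ℚ) b').orderTop)
    (h : x * y = x' * y') : a * b = a' * b' := by
  by_contra hne
  have hy1 : ((1 : ℚ) : WithTop ℚ) ≤ y.orderTop :=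
    pc_le_orderTop_of_sub (dir_le_orderTop_single 1 b) hy
  have hy1' : ((1 : ℚ) : WithTop ℚ) ≤ y'.orderTop :=
    pc_le_orderTop_of_sub (dir_le_orderTop_single 1 b') hy'
  have key : HahnSeries.single ((1 : ℚ) + 1) (a * b - a' * b') =
      ((y' - HahnSeries.single (1 : ℚ) b') * HahnSeries.single (1 : ℚ) a' +
        (x' - HahnSeries.single (1 : ℚ) a') * y') +
      -((y - HahnSeries.single (1 : ℚ) b) * HahnSeries.single (1 : ℚ) a +
        (x - HahnSeries.single (1 : ℚ) a) * y) := by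
    rw [HahnSeries.single_sub, ← HahnSeries.single_mul_single, ← HahnSeries.single_mul_single]
    linear_combination h
  have hL : (HahnSeries.single ((1 : ℚ) + 1) (a * b - a' * b')).orderTop =
      (((1 : ℚ) + 1 : ℚ) : WithTop ℚ) :=
    HahnSeries.orderTop_single (sub_ne_zero.mpr hne)
  have t1 : (((1 : ℚ) + 1 : ℚ) : WithTop ℚ) <
      ((y' - HahnSeries.single (1 : ℚ) b') * HahnSeries.single (1 : ℚ) a').orderTop :=
    pc_lt_orderTop_mul hy' (dir_le_orderTop_single 1 a')
  have t2 : (((1 : ℚ) + 1 : ℚ) : WithTop ℚ) <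
      ((x' - HahnSeries.single (1 : ℚ) a') * y').orderTop :=
    pc_lt_orderTop_mul hx' hy1'
  have t3 : (((1 : ℚ) + 1 : ℚ) : WithTop ℚ) <
      ((y - HahnSeries.single (1 : ℚ) b) * HahnSeries.single (1 : ℚ) a).orderTop :=
    pc_lt_orderTop_mul hy (dir_le_orderTop_single 1 a)
  have t4 : (((1 : ℚ) + 1 : ℚ) : WithTop ℚ) <
      ((x - HahnSeries.single (1 : ℚ) a) * y).orderTop :=
    pc_lt_orderTop_mul hx hy1
  have hR : (((1 : ℚ) + 1 : ℚ) : WithTop ℚ) <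
      (((y' - HahnSeries.single (1 : ℚ) b') * HahnSeries.single (1 : ℚ) a' +
        (x' - HahnSeries.single (1 : ℚ) a') * y') +
      -((y - HahnSeries.single (1 : ℚ) b) * HahnSeries.single (1 : ℚ) a +
        (x - HahnSeries.single (1 : ℚ) a) * y)).orderTop := by
    refine lt_orderTop_add (lt_orderTop_add t1 t2) ?_
    rw [HahnSeries.orderTop_neg]
    exact lt_orderTop_add t3 t4
  rw [← key, hL] at hR
  exact lt_irrefl _ hR

/-- Off the exposed coordinate: `v A > 1` and `v (x - A - s) > 1` give `v (x - s) > 1`. -/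
theorem ttv_off {x A s : HahnSeries ℚ k} (hA : (1 : WithTop ℚ) < A.orderTop)
    (hb : ((1 : ℚ) : WithTop ℚ) < (x - A - s).orderTop) :
    ((1 : ℚ) : WithTop ℚ) < (x - s).orderTop := by
  have hxs : x - s = (x - A - s) + A := by ring
  rw [hxs]
  exact lt_orderTop_add hb (by exact_mod_cast hA)

/-- At the exposed coordinate: `A = t` and `v (x - A - t c) > 1` give `v (x - t (c + 1)) > 1`. -/
theorem ttv_at {x A : HahnSeries ℚ k} {c : k} (hA : A = HahnSeries.single (1 : ℚ) (1 : k))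
    (hb : ((1 : ℚ) : WithTop ℚ) < (x - A - HahnSeries.single (1 : ℚ) c).orderTop) :
    ((1 : ℚ) : WithTop ℚ) < (x - HahnSeries.single (1 : ℚ) (c + 1)).orderTop := by
  have hxs : x - HahnSeries.single (1 : ℚ) (c + 1) = x - A - HahnSeries.single (1 : ℚ) c := by
    rw [hA, HahnSeries.single_add]
    ring
  rw [hxs]
  exact hb

/-- The linear algebra of the seven first-order identities: the vertex identities
`u₀u₃ = u₁u₂`, `u₂u₅ = u₃u₄`, `u₂u₅ = u₀u₆` together with their exposed variants force
`u = 0`. -/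
theorem ttv_algebra {u : Fin 7 → k}
    (e1 : u 0 * u 3 = u 1 * u 2) (e2 : u 2 * u 5 = u 3 * u 4) (e3 : u 2 * u 5 = u 0 * u 6)
    (f0 : (u 0 + 1) * u 3 = u 1 * u 2) (f1 : u 0 * u 3 = (u 1 + 1) * u 2)
    (f2 : u 0 * u 3 = u 1 * (u 2 + 1)) (f3 : u 0 * (u 3 + 1) = u 1 * u 2)
    (g2 : (u 2 + 1) * u 5 = u 3 * u 4) (g3 : u 2 * u 5 = (u 3 + 1) * u 4)
    (h0 : u 2 * u 5 = (u 0 + 1) * u 6) : u = 0 := by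
  have hu0 : u 0 = 0 := by linear_combination f3 - e1
  have hu1 : u 1 = 0 := by linear_combination e1 - f2
  have hu2 : u 2 = 0 := by linear_combination e1 - f1
  have hu3 : u 3 = 0 := by linear_combination f0 - e1
  have hu4 : u 4 = 0 := by linear_combination e2 - g3
  have hu5 : u 5 = 0 := by linear_combination g2 - e2
  have hu6 : u 6 = 0 := by linear_combination e3 - h0
  funext i
  fin_cases i
  exacts [hu0, hu1, hu2, hu3, hu4, hu5, hu6]

/-- **Typed `Rtd` vanishes at the vertex of the toric fourfold `T`** (abstract core; lead c2).
Seven coordinates `G 0, …, G 6 ∈ m` with the binomial relations `G 0 · G 3 = G 1 · G 2`,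
`G 2 · G 5 = G 3 · G 4`, `G 2 · G 5 = G 0 · G 6`, the vertex arc (all `G i ↦ 0`) and, for each
`j < 4`, an exposing arc `a_j` (`a_j (G j) = t`, `v (a_j (G i)) > 1` for `i ≠ j`) admit no typed
straightener `(W, φ)` with `1 ≤ dim W`: realising a direction `u ∈ W ∖ 0` at order `1` from the
vertex arc and from the four exposing arcs (`dir_realise`) and reading the `t²`-coefficients of
the three relations (`ttv_key`) gives ten quadratic identities forcing `u = 0` (`ttv_algebra`).
[folklore] -/
theorem toricT_vertex_core : ∀ {k : Type} [Field k] {K : Type} [Field K] [Algebra k K] {B : Subalgebra k K} {m : Ideal ↥B} (G : Fin 7 → ↥B), (∀ i, G i ∈ m) → G 0 * G 3 = G 1 * G 2 → G 2 * G 5 = G 3 * G 4 → G 2 * G 5 = G 0 * G 6 → (∃ a₀ : {α : ↥B →ₐ[k] HahnSeries ℚ k // ∀ b ∈ m, 0 < (α b).orderTop}, ∀ i, a₀.1 (G i) = 0) → (∀ j : Fin 7, j.val < 4 → ∃ a : {α : ↥B →ₐ[k] HahnSeries ℚ k // ∀ b ∈ m, 0 < (α b).orderTop}, a.1 (G j)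 = HahnSeries.single (1 : ℚ) (1 : k) ∧ ∀ i, i ≠ j → (1 : WithTop ℚ) < (a.1 (G i)).orderTop) → ¬ ∃ W : Submodule k (Fin 7 → k), 1 ≤ Module.finrank k ↥W ∧ ∃ φ : {α : ↥B →ₐ[k] HahnSeries ℚ k // ∀ b ∈ m, 0 < (α b).orderTop} → (Fin 7 → HahnSeries ℚ k), (∀ a b : {α : ↥B →ₐ[k] HahnSeries ℚ k // ∀ b ∈ m, 0 < (α b).orderTop}, a ≠ b → ∃ j, ∀ i, (a.1 (G j) - b.1 (G j)).orderTop < ((φ a i - φ b i) - (a.1 (G i) - b.1 (G i))).orderTop) ∧ (∀ a i, 0 < (φ a i).orderTop) ∧ (∀ a, ∀ w : Fin 7 → HahnSeries ℚ k, (∀ i, 0 < (w i).orderTop) → w ∈ Submodule.span (HahnSeries ℚ k) ((fun u : Fin 7 → k => fun i => HahnSeries.C (u i)) '' (W : Set (Fin 7 → k))) → ∃ b, φ b = φ a + w) := by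
  intro k _ K _ _ B m G _hG hA hB hC ha₀ hexp
  rintro ⟨W, hW, φ, h1, -, h3⟩
  -- a nonzero direction
  obtain ⟨u, hu, hu0⟩ : ∃ u ∈ W, u ≠ 0 := by
    by_contra hcon
    push Not at hcon
    have hbot : W = ⊥ := (Submodule.eq_bot_iff _).mpr hcon
    rw [hbot, finrank_bot] at hW
    exact absurd hW (by norm_num)
  -- the coordinate family and clause (1) over it
  set cc : {α : ↥B →ₐ[k] HahnSeries ℚ k // ∀ b ∈ m, 0 < (α b).orderTop} → Fin 7 → HahnSeries ℚ k :=
    fun a i => a.1 (G i) with hcc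
  have k1' : ∀ a b, a ≠ b → ∃ j, ∀ i,
      (cc a j - cc b j).orderTop < ((φ a i - φ b i) - (cc a i - cc b i)).orderTop := h1
  -- the three relations along every arc
  have hrelA : ∀ β : {α : ↥B →ₐ[k] HahnSeries ℚ k // ∀ b ∈ m, 0 < (α b).orderTop},
      β.1 (G 0) * β.1 (G 3) = β.1 (G 1) * β.1 (G 2) := fun β => by
    rw [← map_mul, ← map_mul, hA]
  have hrelB : ∀ β : {α : ↥B →ₐ[k] HahnSeries ℚ k // ∀ b ∈ m, 0 < (α b).orderTop},
      β.1 (G 2) * β.1 (G 5) = β.1 (G 3) * β.1 (G 4) := fun β => by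
    rw [← map_mul, ← map_mul, hB]
  have hrelC : ∀ β : {α : ↥B →ₐ[k] HahnSeries ℚ k // ∀ b ∈ m, 0 < (α b).orderTop},
      β.1 (G 2) * β.1 (G 5) = β.1 (G 0) * β.1 (G 6) := fun β => by
    rw [← map_mul, ← map_mul, hC]
  -- STEP 1: the vertex arc
  obtain ⟨a₀, ha₀⟩ := ha₀
  obtain ⟨b₀, -, hb₀⟩ := dir_realise k1' h3 a₀ hu hu0 (e := 1) one_pos
  simp only [hcc, ha₀, sub_zero] at hb₀
  have e1 : u 0 * u 3 = u 1 * u 2 := ttv_key (hb₀ 0) (hb₀ 3) (hb₀ 1) (hb₀ 2) (hrelA b₀)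
  have e2 : u 2 * u 5 = u 3 * u 4 := ttv_key (hb₀ 2) (hb₀ 5) (hb₀ 3) (hb₀ 4) (hrelB b₀)
  have e3 : u 2 * u 5 = u 0 * u 6 := ttv_key (hb₀ 2) (hb₀ 5) (hb₀ 0) (hb₀ 6) (hrelC b₀)
  -- STEP 2: the exposing arcs
  obtain ⟨a0, ha0j, ha0i⟩ := hexp 0 (by decide)
  obtain ⟨b0, -, hb0⟩ := dir_realise k1' h3 a0 hu hu0 (e := 1) one_pos
  simp only [hcc] at hb0
  have f0 : (u 0 + 1) * u 3 = u 1 * u 2 :=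
    ttv_key (ttv_at ha0j (hb0 0)) (ttv_off (ha0i 3 (by decide)) (hb0 3))
      (ttv_off (ha0i 1 (by decide)) (hb0 1)) (ttv_off (ha0i 2 (by decide)) (hb0 2)) (hrelA b0)
  have h0 : u 2 * u 5 = (u 0 + 1) * u 6 :=
    ttv_key (ttv_off (ha0i 2 (by decide)) (hb0 2)) (ttv_off (ha0i 5 (by decide)) (hb0 5))
      (ttv_at ha0j (hb0 0)) (ttv_off (ha0i 6 (by decide)) (hb0 6)) (hrelC b0)
  obtain ⟨a1, ha1j, ha1i⟩ := hexp 1 (by decide)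
  obtain ⟨b1, -, hb1⟩ := dir_realise k1' h3 a1 hu hu0 (e := 1) one_pos
  simp only [hcc] at hb1
  have f1 : u 0 * u 3 = (u 1 + 1) * u 2 :=
    ttv_key (ttv_off (ha1i 0 (by decide)) (hb1 0)) (ttv_off (ha1i 3 (by decide)) (hb1 3))
      (ttv_at ha1j (hb1 1)) (ttv_off (ha1i 2 (by decide)) (hb1 2)) (hrelA b1)
  obtain ⟨a2, ha2j, ha2i⟩ := hexp 2 (by decide)
  obtain ⟨b2, -, hb2⟩ := dir_realise k1' h3 a2 hu hu0 (e := 1) one_pos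
  simp only [hcc] at hb2
  have f2 : u 0 * u 3 = u 1 * (u 2 + 1) :=
    ttv_key (ttv_off (ha2i 0 (by decide)) (hb2 0)) (ttv_off (ha2i 3 (by decide)) (hb2 3))
      (ttv_off (ha2i 1 (by decide)) (hb2 1)) (ttv_at ha2j (hb2 2)) (hrelA b2)
  have g2 : (u 2 + 1) * u 5 = u 3 * u 4 :=
    ttv_key (ttv_at ha2j (hb2 2)) (ttv_off (ha2i 5 (by decide)) (hb2 5))
      (ttv_off (ha2i 3 (by decide)) (hb2 3)) (ttv_off (ha2i 4 (by decide)) (hb2 4)) (hrelB b2)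
  obtain ⟨a3, ha3j, ha3i⟩ := hexp 3 (by decide)
  obtain ⟨b3, -, hb3⟩ := dir_realise k1' h3 a3 hu hu0 (e := 1) one_pos
  simp only [hcc] at hb3
  have f3 : u 0 * (u 3 + 1) = u 1 * u 2 :=
    ttv_key (ttv_off (ha3i 0 (by decide)) (hb3 0)) (ttv_at ha3j (hb3 3))
      (ttv_off (ha3i 1 (by decide)) (hb3 1)) (ttv_off (ha3i 2 (by decide)) (hb3 2)) (hrelA b3)
  have g3 : u 2 * u 5 = (u 3 + 1) * u 4 :=
    ttv_key (ttv_off (ha3i 2 (by decide)) (hb3 2)) (ttv_off (ha3i 5 (by decide)) (hb3 5))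
      (ttv_at ha3j (hb3 3)) (ttv_off (ha3i 4 (by decide)) (hb3 4)) (hrelB b3)
  exact hu0 (ttv_algebra e1 e2 e3 f0 f1 f2 f3 g2 g3 h0)

end ToricTVertex

end Summit.ResolutionOfSingularities.ResolutionOfSingularities.Theorems

end
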